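/-
Copyright (c) 2026 the pub-hodgecm-mathlib formalisation cell (harness21).  Prover seat hodgecm-mathlib-K2E3-p23 (g2): Track B «K2-LIT», engine E3, line (ii′)
«H-side central germ expansion» (line lead K2E4-p06 (g2)), leaf (E) `sig_K2E3CentralGermExpansionExistence`, brick (E5) «FAR_z» (far support at a central point); 2026-09-04.
-/
import Literature.NumberTheory.Rogawski1990.UnitaryTwoOneCentralUnipotentStrataCM   -- ★ p855879 (E2b) (this seat): `cmDatum_local_one_mul_comm`, `fst_comm_of_mem_center`; brings the N = 2 dictionary ★ p855844 and (E1) ★ p855739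
import Literature.NumberTheory.Automorphic.LocalEndoscopicOrbitClosed               -- ★ `isGRegular_of_isStablyConjH`, `IsStablyConj.charpoly_eq`, `isStablyConj_iff_eq_of_fin_one` (via `EndoscopicClassTransfer`), the H-side carriers
import Literature.NumberTheory.Automorphic.CMLocalRankOneClassMapOpen                -- ★ `galAdicCompletionMap_coe`, `imagUnit`, `complexConj_imagUnit`, `imagUnit_ne_zero` (a skew unit of `L_w`)
import HarnessLib

/-!
# FAR SUPPORT AT A CENTRAL POINT of `H_v = U(Φ₂)(L⁺_v) × U(Φ₁)(L⁺_v)`: a compactly supported function vanishing near the stratum over `z` has vanishing orbital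
# integrands on every STABLE class close to `z` (Rogawski 1990 §8.1 p. 113 l. 20, the `F₁`-part of Howe's argument, rank-one × abelian, centred)

Topic `NumberTheory/Rogawski1990`; namespace `Literature.NumberTheory.Rogawski1990`.  THEOREMS ONLY (no definition, no instance, no notation, no named fact, no `sorry`);
kernel lane `--supports stmt-HodgeConjecture-24833`.  Cell `pub/hodgecm-mathlib` (D-0151), crux H413 = `stmt-HodgeConjecture-24833`; Track B «K2-LIT», engine E3, tier-1 unit
`…Sigs_U3bCentralGerms`, line (ii′) (line lead K2E4-p06 (g2)), leaf **(E) `sig_K2E3CentralGermExpansionExistence`** (aea6e516723791cf), brick **(E5) «FAR_z»** of K2E3-p23 (g2)'s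
programme ((E1) ★ p855739 · (E2) ★ p855772 ∕ p855844 ∕ p855879 · (E3) ‹RAO_z› · (E4) ‹DUAL_z› (K2E4-p21) · (E5) PLUG): the CENTRED twin of ★ SH-1 `ShalikaGermExpansionFarSupport`
(`exists_nhds_charpolyCoeff_classOrbitalIntegral_eq_zero_of_tsupport`), which is phrased at the identity through a matrix representation; at a central `z ≠ 1` no representation
of `H_v` has «unipotent variety = the classes over `z`», so the invariant is re-cut here as `χ_z(h) = (tr((h z⁻¹)₁), det((h z⁻¹)₁), (h z⁻¹)₂)`.
HONEST LABEL: HC_CM is proved only modulo the 7 printed citations (2 remaining named inputs: hLiu418 = stmt-HodgeConjecture-24832, h413 = stmt-HodgeConjecture-24833) until rung 0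
closes; count-neutral brick (consumed by `Theorems/K2E3CentralGermExpansionExistenceOfRao.lean`).

THE MATHEMATICS.  `z = (z₁, z₂) ∈ Z(H_v)`.  (§1) `z₁` IS A SCALAR MATRIX: read in the one-place model `ψ : U(Φ₂)(L⁺_v) ≃ U(σ_w, J₀)(L_w)` (★ `localNonsplitEquiv`, one place `w ∣ v`),
`ψ z₁` commutes with `n(t₀) = (1, t₀; 0, 1)` (`t₀ = √(−Δ)` the skew unit ★ `imagUnit`, ★ `mem_unitaryGroupOfForm_iff_of_coe_eq_lineUnipotent`) and with the flip `antidiag(1,1)` (★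
`antidiagPermTwo_mem_unitaryGroupOfForm`), hence is `ζ·1`; one place above `v` transports this to the matrix of `z₁` over `L ⊗ L⁺_v = ∏_{w′∣v} L_{w′}`.  (§2) Hence
`χ_z` is constant on STABLE classes (★ `IsStablyConj` = conjugacy in the ambient `GL₂`, ★ `Matrix.trace_units_conj` ∕ `det_units_conj`, the scalar `z₁⁻¹` commuting with `GL₂`; the
`U(Φ₁)`-parts of stably conjugate pairs are EQUAL, ★ `isStablyConj_iff_eq_of_fin_one`), continuous, and `χ_z(h) = χ_z(z) = (2, 1, 1)` forces `h` over `z` (Cayley–Hamilton in `M₂`: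
`A² − tr A·A + det A = 0`, so `tr A = 2`, `det A = 1` give `(A − 1)² = 0`).  (§3) FAR_z: if `tsupport F₁` is compact and misses the stratum over `z`, then `χ_z(tsupport F₁)` is a compact,
hence closed, set not containing `χ_z(z)`, and on the open `V = χ_z⁻¹(χ_z(tsupport F₁))ᶜ ∋ z` every stable conjugate of every `γ ∈ V`, and every `H_v`-conjugate of it, lies off
`tsupport F₁`: `F₁(x δ x⁻¹) = 0`.

* §1 `exists_coe_fst_eq_smul_one_of_mem_center` (central ⇒ `z₁` scalar over `L ⊗ L⁺_v`);
* §2 `trace_det_snd_eq_of_isLocalStablyConjH` (`χ_z` is a stable-class function), `sub_one_sq_eq_zero_of_trace_eq_two_of_det_eq_one` (Cayley–Hamilton, `2 × 2`);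
* §3 **`exists_nhds_forall_isLocalStablyConjH_conj_apply_eq_zero`** (FAR_z).

## References
* [Rogawski1990] J. D. Rogawski, *Automorphic Representations of Unitary Groups in Three Variables*, Ann. of Math. Stud. 123 (1990): §8.1 Prop. 8.1.1 proof p. 113 (l. 20: the remainder
  `F₁` vanishes near the unipotent set); §3.1 p. 19 (stable conjugacy); §4.9 p. 54 (`H = U(2) × U(1)`).
* [Howe1974] R. Howe, *The Fourier transform and germs of characters (case of Gl_n over a p-adic field)*, Math. Ann. 208 (1974) 305–322, Prop. 2.
* [PlatonovRapinchuk1994] V. Platonov, A. Rapinchuk, *Algebraic Groups and Number Theory* (1994), §5.1.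
-/

set_option autoImplicit false

noncomputable section

open scoped Matrix MatrixGroups Classical
open NumberField IsDedekindDomain Matrix Set Topology Filter

namespace Literature.NumberTheory.Rogawski1990

open Literature.NumberTheory.Automorphic Literature.NumberTheory.Automorphic.UnitaryGroup Literature.NumberTheory.GaloisRepresentations
open Literature.NumberTheory.Automorphic.HermitianLattice
open Literature.NumberTheory.GelbartRogawski1991.UnitaryDualPair (imagUnit complexConj_imagUnit imagUnit_ne_zero)

section Central

variable (L : Type) [Field L] [NumberField L] [IsCMField L] (v : HeightOneSpectrum (𝓞 ↥(maximalRealSubfield L)))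

/-! ## §1 A central element of `H_v` has scalar `U(Φ₂)`-part -/

set_option maxHeartbeats 800000 in
-- one-place transport + a 2 × 2 matrix computation
/-- **CENTRAL ⇒ SCALAR**: for `z ∈ Z(H_v)` (one place `w` above `v`), the matrix of `z₁ ∈ U(Φ₂)(L⁺_v) ≤ GL₂(L ⊗ L⁺_v)` is `ζ·1` for a unit `ζ`.  (In the one-place model
`ψ : U(Φ₂)(L⁺_v) ≃ U(σ_w, J₀)(L_w)`, `ψ z₁` commutes with `n(t₀)`, `t₀` the skew unit `√(−Δ)`, forcing `(ψ z₁)₁₀ = 0`, `(ψ z₁)₀₀ = (ψ z₁)₁₁`, and with the flip `antidiag(1, 1)`, forcing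
`(ψ z₁)₀₁ = (ψ z₁)₁₀`; one place above `v` reads the matrix over `L ⊗ L⁺_v` off its `w`-component.) [cite: Rogawski1990, §1.9 p. 8; §4.9 p. 54] [cite: PlatonovRapinchuk1994, §5.1] -/
theorem exists_coe_fst_eq_smul_one_of_mem_center (w : UnitaryGroup.PlacesOver L v) (hsub : Subsingleton (UnitaryGroup.PlacesOver L v))
    {z : (cmDatum L 2 (Matrix.of fun i j : Fin 2 => if i.val + j.val + 1 = 2 then (1 : L) else 0)).Local v × (cmDatum L 1 (Matrix.of fun i j : Fin 1 => if i.val + j.val + 1 = 1 then (1 : L) else 0)).Local v}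
    (hz : z ∈ Subgroup.center ((cmDatum L 2 (Matrix.of fun i j : Fin 2 => if i.val + j.val + 1 = 2 then (1 : L) else 0)).Local v ×
      (cmDatum L 1 (Matrix.of fun i j : Fin 1 => if i.val + j.val + 1 = 1 then (1 : L) else 0)).Local v)) :
    ∃ ζ : UnitaryGroup.LocalRing L v, IsUnit ζ ∧ ((z.1).val : GL (Fin 2) (UnitaryGroup.LocalRing L v)).val = ζ • (1 : Matrix (Fin 2) (Fin 2) (UnitaryGroup.LocalRing L v)) := by
  haveI : Algebra.IsQuadraticExtension ↥(maximalRealSubfield L) L := IsCMField.isQuadraticExtension L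
  have hw : IsCMField.complexConj L • w.1 = w.1 := smul_placesOver_eq_of_subsingleton L v (IsCMField.complexConj L) hsub w
  have hσσ : ∀ x : w.1.adicCompletion L, galAdicCompletionMap (L := L) (IsCMField.complexConj L) hw (galAdicCompletionMap (L := L) (IsCMField.complexConj L) hw x) = x :=
    galAdicCompletionMap_galAdicCompletionMap_of_smul_eq (IsCMField.complexConj L) w (IsCMField.complexConj_ne_one L) hw
  haveI : CharZero (w.1.adicCompletion L) := charZero_of_injective_algebraMap (algebraMap L _).injective
  -- the skew unit `t₀ = √(−Δ)` of `L_w`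
  have ht₀σ : galAdicCompletionMap (L := L) (IsCMField.complexConj L) hw (algebraMap L (w.1.adicCompletion L) (imagUnit L)) = -(algebraMap L (w.1.adicCompletion L) (imagUnit L)) := by
    have h := galAdicCompletionMap_coe (L := L) (IsCMField.complexConj L) hw (imagUnit L)
    rw [show ((IsCMField.complexConj L) • imagUnit L : L) = -imagUnit L from complexConj_imagUnit L] at h
    change galAdicCompletionMap (L := L) (IsCMField.complexConj L) hw ((imagUnit L : L) : w.1.adicCompletion L) = -(((imagUnit L : L)) : w.1.adicCompletion L)
    rw [h]
    change algebraMap L (w.1.adicCompletion L) (-imagUnit L) = -(algebraMap L (w.1.adicCompletion L) (imagUnit L))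
    exact map_neg _ _
  have ht₀0 : algebraMap L (w.1.adicCompletion L) (imagUnit L) ≠ 0 := by
    have h := (algebraMap L (w.1.adicCompletion L)).injective.ne (imagUnit_ne_zero L)
    rwa [map_zero] at h
  set t₀ := algebraMap L (w.1.adicCompletion L) (imagUnit L) with ht₀
  -- the one-place model, read in `GL₂(L_w)`
  obtain ⟨ψ, hψ⟩ : ∃ ψ : (cmDatum L 2 (Matrix.of fun i j : Fin 2 => if i.val + j.val + 1 = 2 then (1 : L) else 0)).Local v → GL (Fin 2) (w.1.adicCompletion L), ∀ y, ψ y =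
      ((localNonsplitEquiv (IsCMField.complexConj L) (Matrix.of fun i j : Fin 2 => if i.val + j.val + 1 = 2 then (1 : L) else 0) (IsCMField.complexConj_ne_one L) w hw y :
        ↥(unitaryGroupOfForm (galAdicCompletionMap (L := L) (IsCMField.complexConj L) hw)
          (placeForm (Matrix.of fun i j : Fin 2 => if i.val + j.val + 1 = 2 then (1 : L) else 0) w.1))) : GL (Fin 2) (w.1.adicCompletion L)) :=
    ⟨_, fun _ => rfl⟩
  have hψmul : ∀ y y', ψ (y * y') = ψ y * ψ y' := fun y y' => by
    rw [hψ, hψ, hψ]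
    exact congrArg Subtype.val (map_mul (localNonsplitEquiv (IsCMField.complexConj L) _ (IsCMField.complexConj_ne_one L) w hw) y y')
  -- every `g ∈ U(σ_w, J₀)(L_w)` commutes with `M := ψ z₁`
  have hcomm : ∀ g : GL (Fin 2) (w.1.adicCompletion L), g ∈ unitaryGroupOfForm (galAdicCompletionMap (L := L) (IsCMField.complexConj L) hw) ((StdForm.antidiagonal 2).over (w.1.adicCompletion L)) →
      g * ψ z.1 = ψ z.1 * g := by
    intro g hg
    have hg' : g ∈ unitaryGroupOfForm (galAdicCompletionMap (L := L) (IsCMField.complexConj L) hw)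
        (placeForm (Matrix.of fun i j : Fin 2 => if i.val + j.val + 1 = 2 then (1 : L) else 0) w.1) := by rw [placeForm_antidiagTwo_eq_over L w]; exact hg
    obtain ⟨k, hk⟩ : ∃ k : (cmDatum L 2 (Matrix.of fun i j : Fin 2 => if i.val + j.val + 1 = 2 then (1 : L) else 0)).Local v, ψ k = g :=
      ⟨(localNonsplitEquiv (IsCMField.complexConj L) _ (IsCMField.complexConj_ne_one L) w hw).symm ⟨g, hg'⟩, by
        rw [hψ]
        exact congrArg Subtype.val ((localNonsplitEquiv (IsCMField.complexConj L) _ (IsCMField.complexConj_ne_one L) w hw).apply_symm_apply ⟨g, hg'⟩)⟩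
    rw [← hk, ← hψmul, ← hψmul, (fst_comm_of_mem_center hz k).1]
  -- `n(t₀)` and the flip are in `U(σ_w, J₀)(L_w)`
  obtain ⟨n, hn, -⟩ := exists_units_coe_eq_lineUnipotent (K := w.1.adicCompletion L) t₀
  have hnU : n ∈ unitaryGroupOfForm (galAdicCompletionMap (L := L) (IsCMField.complexConj L) hw) ((StdForm.antidiagonal 2).over (w.1.adicCompletion L)) :=
    (mem_unitaryGroupOfForm_iff_of_coe_eq_lineUnipotent (galAdicCompletionMap (L := L) (IsCMField.complexConj L) hw) hn).2 (by rw [ht₀σ, neg_add_cancel])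
  obtain ⟨f, hf, -⟩ := exists_units_coe_eq_antidiagPermTwo (K := w.1.adicCompletion L)
  have hfU : f ∈ unitaryGroupOfForm (galAdicCompletionMap (L := L) (IsCMField.complexConj L) hw) ((StdForm.antidiagonal 2).over (w.1.adicCompletion L)) :=
    antidiagPermTwo_mem_unitaryGroupOfForm (galAdicCompletionMap (L := L) (IsCMField.complexConj L) hw) hf
  -- the 2 × 2 computation: `M = a·1`
  set M : Matrix (Fin 2) (Fin 2) (w.1.adicCompletion L) := ((ψ z.1 : GL (Fin 2) (w.1.adicCompletion L)) : Matrix (Fin 2) (Fin 2) (w.1.adicCompletion L)) with hM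
  have hMn : (n : Matrix (Fin 2) (Fin 2) (w.1.adicCompletion L)) * M = M * (n : Matrix (Fin 2) (Fin 2) (w.1.adicCompletion L)) := by
    have h := congrArg (fun u : GL (Fin 2) (w.1.adicCompletion L) => (u : Matrix (Fin 2) (Fin 2) (w.1.adicCompletion L))) (hcomm n hnU)
    simpa only [Units.val_mul] using h
  have hMf : (f : Matrix (Fin 2) (Fin 2) (w.1.adicCompletion L)) * M = M * (f : Matrix (Fin 2) (Fin 2) (w.1.adicCompletion L)) := by
    have h := congrArg (fun u : GL (Fin 2) (w.1.adicCompletion L) => (u : Matrix (Fin 2) (Fin 2) (w.1.adicCompletion L))) (hcomm f hfU)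
    simpa only [Units.val_mul] using h
  rw [hn, Matrix.eta_fin_two M] at hMn
  rw [hf, Matrix.eta_fin_two M] at hMf
  have e00 := congrArg (fun A : Matrix (Fin 2) (Fin 2) (w.1.adicCompletion L) => A 0 0) hMn
  have e01 := congrArg (fun A : Matrix (Fin 2) (Fin 2) (w.1.adicCompletion L) => A 0 1) hMn
  have f00 := congrArg (fun A : Matrix (Fin 2) (Fin 2) (w.1.adicCompletion L) => A 0 0) hMf
  simp only [Matrix.mul_fin_two, Matrix.of_apply, Matrix.cons_val', Matrix.cons_val_zero, Matrix.cons_val_one, Matrix.empty_val', Matrix.cons_val_fin_one,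
    one_mul, mul_one, zero_mul, mul_zero, add_zero, zero_add] at e00 e01 f00
  -- e00 : M 0 0 + t₀ * M 1 0 = M 0 0 ;  e01 : M 0 1 + t₀ * M 1 1 = M 0 0 * t₀ + M 0 1 ;  f00 : M 1 0 = M 0 1
  have h10 : M 1 0 = 0 := by
    have h : t₀ * M 1 0 = 0 := by linear_combination e00
    rcases mul_eq_zero.1 h with h | h
    · exact absurd h ht₀0
    · exact h
  have h11 : M 1 1 = M 0 0 := by
    have h : t₀ * (M 1 1 - M 0 0) = 0 := by linear_combination e01
    rcases mul_eq_zero.1 h with h | h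
    · exact absurd h ht₀0
    · exact sub_eq_zero.1 h
  have h01 : M 0 1 = 0 := by rw [← f00, h10]
  have hMscalar : M = M 0 0 • (1 : Matrix (Fin 2) (Fin 2) (w.1.adicCompletion L)) := by
    rw [Matrix.eta_fin_two M]
    ext i j
    fin_cases i <;> fin_cases j <;> simp [h10, h11, h01]
  -- transport to `L ⊗ L⁺_v = ∏_{w′ ∣ v} L_{w′}` (one place above `v`)
  have hcoe : M = (((z.1).val : GL (Fin 2) (UnitaryGroup.LocalRing L v)).val).map (Pi.evalRingHom (fun w' : UnitaryGroup.PlacesOver L v => w'.1.adicCompletion L) w) := by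
    rw [hM, hψ, coe_coe_localNonsplitEquiv_apply]
  have hmat : ((z.1).val : GL (Fin 2) (UnitaryGroup.LocalRing L v)).val =
      (((z.1).val : GL (Fin 2) (UnitaryGroup.LocalRing L v)).val) 0 0 • (1 : Matrix (Fin 2) (Fin 2) (UnitaryGroup.LocalRing L v)) := by
    refine Matrix.ext fun i j => funext fun w' => ?_
    obtain rfl : w = w' := Subsingleton.elim w w'
    have hMij : M i j = ((((z.1).val : GL (Fin 2) (UnitaryGroup.LocalRing L v)).val) i j) w := by
      have h := congrFun (congrFun hcoe i) j
      rw [Matrix.map_apply] at h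
      exact h
    have hM00 : M 0 0 = ((((z.1).val : GL (Fin 2) (UnitaryGroup.LocalRing L v)).val) 0 0) w := by
      have h := congrFun (congrFun hcoe 0) 0
      rw [Matrix.map_apply] at h
      exact h
    have hij : M i j = (M 0 0 • (1 : Matrix (Fin 2) (Fin 2) (w.1.adicCompletion L))) i j := congrFun (congrFun hMscalar i) j
    rw [hMij, hM00, Matrix.smul_apply, smul_eq_mul, Matrix.one_apply] at hij
    rw [Matrix.smul_apply, smul_eq_mul, Pi.mul_apply, Matrix.one_apply, hij]
    by_cases hij' : i = j
    · rw [if_pos hij', if_pos hij', Pi.one_apply]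
    · rw [if_neg hij', if_neg hij', Pi.zero_apply]
  refine ⟨(((z.1).val : GL (Fin 2) (UnitaryGroup.LocalRing L v)).val) 0 0, ?_, hmat⟩
  -- `ζ = (z₁)₀₀` is a unit: `det z₁ = ζ²` is
  have hdet : IsUnit (((z.1).val : GL (Fin 2) (UnitaryGroup.LocalRing L v)).val).det := ((z.1).val : GL (Fin 2) (UnitaryGroup.LocalRing L v)).isUnit.map Matrix.detMonoidHom
  rw [hmat, Matrix.det_smul, Matrix.det_one, mul_one, Fintype.card_fin] at hdet
  exact (isUnit_pow_iff two_ne_zero).1 hdet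

/-! ## §2 The invariant `χ_z(h) = (tr((h z⁻¹)₁), det((h z⁻¹)₁), (h z⁻¹)₂)` -/

variable {L v} in
/-- **`χ_z` is a STABLE-class function**: stably conjugate `γ, δ ∈ H_v` (★ `IsLocalStablyConjH` = `GL₂`-conjugacy of the first components, equality of the second) have the same
`tr((· z⁻¹)₁)`, `det((· z⁻¹)₁)`, `(· z⁻¹)₂` — the scalar `z₁⁻¹` (§1, for the central `z⁻¹`) commutes with `GL₂(L ⊗ L⁺_v)`. [cite: Rogawski1990, §3.1 p. 19; §4.9 p. 54] -/
theorem trace_det_snd_eq_of_isLocalStablyConjH (w : UnitaryGroup.PlacesOver L v) (hsub : Subsingleton (UnitaryGroup.PlacesOver L v))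
    {z : (cmDatum L 2 (Matrix.of fun i j : Fin 2 => if i.val + j.val + 1 = 2 then (1 : L) else 0)).Local v × (cmDatum L 1 (Matrix.of fun i j : Fin 1 => if i.val + j.val + 1 = 1 then (1 : L) else 0)).Local v}
    (hz : z ∈ Subgroup.center ((cmDatum L 2 (Matrix.of fun i j : Fin 2 => if i.val + j.val + 1 = 2 then (1 : L) else 0)).Local v ×
      (cmDatum L 1 (Matrix.of fun i j : Fin 1 => if i.val + j.val + 1 = 1 then (1 : L) else 0)).Local v))
    {γ δ : (cmDatum L 2 (Matrix.of fun i j : Fin 2 => if i.val + j.val + 1 = 2 then (1 : L) else 0)).Local v × (cmDatum L 1 (Matrix.of fun i j : Fin 1 => if i.val + j.val + 1 = 1 then (1 : L) else 0)).Local v}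
    (h : IsLocalStablyConjH L v γ δ) :
    (((δ * z⁻¹).1).val : GL (Fin 2) (UnitaryGroup.LocalRing L v)).val.trace = (((γ * z⁻¹).1).val : GL (Fin 2) (UnitaryGroup.LocalRing L v)).val.trace ∧
      (((δ * z⁻¹).1).val : GL (Fin 2) (UnitaryGroup.LocalRing L v)).val.det = (((γ * z⁻¹).1).val : GL (Fin 2) (UnitaryGroup.LocalRing L v)).val.det ∧
      (δ * z⁻¹).2 = (γ * z⁻¹).2 := by
  have hzinv : z⁻¹ ∈ Subgroup.center ((cmDatum L 2 (Matrix.of fun i j : Fin 2 => if i.val + j.val + 1 = 2 then (1 : L) else 0)).Local v ×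
      (cmDatum L 1 (Matrix.of fun i j : Fin 1 => if i.val + j.val + 1 = 1 then (1 : L) else 0)).Local v) := inv_mem hz
  obtain ⟨ζ, -, hζ⟩ := exists_coe_fst_eq_smul_one_of_mem_center L v w hsub hzinv
  -- `z₁⁻¹` is the scalar `ζ` in `GL₂(L ⊗ L⁺_v)`
  have hzmat : (((z⁻¹).1).val : GL (Fin 2) (UnitaryGroup.LocalRing L v)).val = ζ • (1 : Matrix (Fin 2) (Fin 2) (UnitaryGroup.LocalRing L v)) := hζ
  have hfst : ∀ x : (cmDatum L 2 (Matrix.of fun i j : Fin 2 => if i.val + j.val + 1 = 2 then (1 : L) else 0)).Local v × (cmDatum L 1 (Matrix.of fun i j : Fin 1 => if i.val + j.val + 1 = 1 then (1 : L) else 0)).Local v,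
      (((x * z⁻¹).1).val : GL (Fin 2) (UnitaryGroup.LocalRing L v)).val = ((x.1).val : GL (Fin 2) (UnitaryGroup.LocalRing L v)).val * (ζ • (1 : Matrix (Fin 2) (Fin 2) (UnitaryGroup.LocalRing L v))) := by
    intro x
    rw [← hzmat]
    rfl
  obtain ⟨g, hg⟩ := isConj_iff.1 h.1
  -- `δ₁ = g γ₁ g⁻¹` in `GL₂`
  have hg' : ((δ.1).val : GL (Fin 2) (UnitaryGroup.LocalRing L v)).val = (g : GL (Fin 2) (UnitaryGroup.LocalRing L v)).val * ((γ.1).val : GL (Fin 2) (UnitaryGroup.LocalRing L v)).val * (g⁻¹ : GL (Fin 2) (UnitaryGroup.LocalRing L v)).val := by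
    have h' := congrArg (fun u : GL (Fin 2) (UnitaryGroup.LocalRing L v) => u.val) hg
    simp only [Units.val_mul] at h'
    exact h'.symm
  have hconj : (((δ * z⁻¹).1).val : GL (Fin 2) (UnitaryGroup.LocalRing L v)).val =
      (g : GL (Fin 2) (UnitaryGroup.LocalRing L v)).val * (((γ * z⁻¹).1).val : GL (Fin 2) (UnitaryGroup.LocalRing L v)).val * (g⁻¹ : GL (Fin 2) (UnitaryGroup.LocalRing L v)).val := by
    rw [hfst δ, hfst γ, hg']
    simp only [Matrix.mul_smul, Matrix.mul_one, Matrix.smul_mul]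
  refine ⟨?_, ?_, ?_⟩
  · rw [hconj, Matrix.trace_units_conj]
  · rw [hconj, Matrix.det_units_conj]
  · have h2 : γ.2 = δ.2 := (isStablyConj_iff_eq_of_fin_one.1 h.2)
    show δ.2 * (z⁻¹).2 = γ.2 * (z⁻¹).2
    rw [h2]

omit [NumberField L] [IsCMField L] in
/-- **Cayley–Hamilton in `M₂`**: over a commutative ring, `tr A = 2` and `det A = 1` give `(A − 1)² = 0` (`A² − tr A·A + det A·1 = 0`). [cite: Rogawski1990, §3.9 p. 32] -/
theorem sub_one_sq_eq_zero_of_trace_eq_two_of_det_eq_one {R : Type*} [CommRing R] (A : Matrix (Fin 2) (Fin 2) R) (htr : A.trace = 2) (hdet : A.det = 1) :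
    (A - 1) ^ 2 = 0 := by
  have hCH : A * A - A.trace • A + A.det • (1 : Matrix (Fin 2) (Fin 2) R) = 0 := by
    rw [Matrix.trace_fin_two, Matrix.det_fin_two, Matrix.eta_fin_two A]
    ext i j
    fin_cases i <;> fin_cases j <;> simp [Matrix.smul_apply] <;> ring
  rw [htr, hdet, one_smul, two_smul] at hCH
  rw [pow_two]
  calc (A - 1) * (A - 1) = A * A - (A + A) + 1 := by noncomm_ring
    _ = 0 := hCH

/-! ## §3 FAR_z -/

set_option maxHeartbeats 800000 in
-- continuity bookkeeping on the product carrier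
/-- **FAR SUPPORT AT A CENTRAL `z`** (one place above `v`): if `F₁ : H_v → ℂ` has compact support which misses the stratum over `z` (`((h z⁻¹)₁ − 1)² = 0 ∧ (h z⁻¹)₂ = 1`), then there
is a neighbourhood `V` of `z` such that for every `γ ∈ V`, every `δ` STABLY conjugate to `γ` and every `x ∈ H_v`, `F₁(x δ x⁻¹) = 0` — so every orbital integrand of `F₁` over a class
of the stable class of `γ` vanishes identically.  (`V = χ_z⁻¹(χ_z(tsupport F₁))ᶜ` for the continuous stable-class function `χ_z` of §2; `χ_z(h) = χ_z(z)` would force `h` over `z` by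
§2's Cayley–Hamilton.) The centred rank-one twin of ★ SH-1 `exists_nhds_charpolyCoeff_classOrbitalIntegral_eq_zero_of_tsupport`.
[cite: Rogawski1990, §8.1 Prop. 8.1.1 proof p. 113] [cite: Howe1974, Prop. 2] -/
theorem exists_nhds_forall_isLocalStablyConjH_conj_apply_eq_zero (w : UnitaryGroup.PlacesOver L v) (hsub : Subsingleton (UnitaryGroup.PlacesOver L v))
    {z : (cmDatum L 2 (Matrix.of fun i j : Fin 2 => if i.val + j.val + 1 = 2 then (1 : L) else 0)).Local v × (cmDatum L 1 (Matrix.of fun i j : Fin 1 => if i.val + j.val + 1 = 1 then (1 : L) else 0)).Local v}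
    (hz : z ∈ Subgroup.center ((cmDatum L 2 (Matrix.of fun i j : Fin 2 => if i.val + j.val + 1 = 2 then (1 : L) else 0)).Local v ×
      (cmDatum L 1 (Matrix.of fun i j : Fin 1 => if i.val + j.val + 1 = 1 then (1 : L) else 0)).Local v))
    {V : Type*} [Zero V] [TopologicalSpace V]
    (F₁ : (cmDatum L 2 (Matrix.of fun i j : Fin 2 => if i.val + j.val + 1 = 2 then (1 : L) else 0)).Local v × (cmDatum L 1 (Matrix.of fun i j : Fin 1 => if i.val + j.val + 1 = 1 then (1 : L) else 0)).Local v → V)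
    (hF₁ : HasCompactSupport F₁)
    (hfar : ∀ h ∈ tsupport F₁, ¬ (((((h * z⁻¹).1).val : GL (Fin 2) (UnitaryGroup.LocalRing L v)).val - 1) ^ 2 = 0 ∧ (h * z⁻¹).2 = 1)) :
    ∃ U ∈ 𝓝 z, ∀ γ ∈ U, ∀ δ : (cmDatum L 2 (Matrix.of fun i j : Fin 2 => if i.val + j.val + 1 = 2 then (1 : L) else 0)).Local v × (cmDatum L 1 (Matrix.of fun i j : Fin 1 => if i.val + j.val + 1 = 1 then (1 : L) else 0)).Local v,
      IsLocalStablyConjH L v γ δ → ∀ x : (cmDatum L 2 (Matrix.of fun i j : Fin 2 => if i.val + j.val + 1 = 2 then (1 : L) else 0)).Local v × (cmDatum L 1 (Matrix.of fun i j : Fin 1 => if i.val + j.val + 1 = 1 then (1 : L) else 0)).Local v,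
        F₁ (x * δ * x⁻¹) = 0 := by
  -- the invariant `χ_z`
  obtain ⟨χ, hχ⟩ : ∃ χ : (cmDatum L 2 (Matrix.of fun i j : Fin 2 => if i.val + j.val + 1 = 2 then (1 : L) else 0)).Local v × (cmDatum L 1 (Matrix.of fun i j : Fin 1 => if i.val + j.val + 1 = 1 then (1 : L) else 0)).Local v →
      (UnitaryGroup.LocalRing L v × UnitaryGroup.LocalRing L v) × (cmDatum L 1 (Matrix.of fun i j : Fin 1 => if i.val + j.val + 1 = 1 then (1 : L) else 0)).Local v,
      ∀ h, χ h = (((((h * z⁻¹).1).val : GL (Fin 2) (UnitaryGroup.LocalRing L v)).val.trace, (((h * z⁻¹).1).val : GL (Fin 2) (UnitaryGroup.LocalRing L v)).val.det), (h * z⁻¹).2) :=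
    ⟨_, fun _ => rfl⟩
  have hχc : Continuous χ := by
    have h0 : Continuous fun h : (cmDatum L 2 (Matrix.of fun i j : Fin 2 => if i.val + j.val + 1 = 2 then (1 : L) else 0)).Local v ×
        (cmDatum L 1 (Matrix.of fun i j : Fin 1 => if i.val + j.val + 1 = 1 then (1 : L) else 0)).Local v => h * z⁻¹ := continuous_id.mul continuous_const
    have h1 : Continuous fun h : (cmDatum L 2 (Matrix.of fun i j : Fin 2 => if i.val + j.val + 1 = 2 then (1 : L) else 0)).Local v ×
        (cmDatum L 1 (Matrix.of fun i j : Fin 1 => if i.val + j.val + 1 = 1 then (1 : L) else 0)).Local v =>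
        (((h * z⁻¹).1).val : GL (Fin 2) (UnitaryGroup.LocalRing L v)).val :=
      Units.continuous_val.comp (continuous_subtype_val.comp (continuous_fst.comp h0))
    have hfun : χ = fun h => (((((h * z⁻¹).1).val : GL (Fin 2) (UnitaryGroup.LocalRing L v)).val.trace, (((h * z⁻¹).1).val : GL (Fin 2) (UnitaryGroup.LocalRing L v)).val.det), (h * z⁻¹).2) :=
      funext hχ
    rw [hfun]
    exact ((h1.matrix_trace.prodMk h1.matrix_det).prodMk (continuous_snd.comp h0))
  -- `χ_z` is a stable-class function, and conjugation-invariant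
  have hχst : ∀ γ δ, IsLocalStablyConjH L v γ δ → χ δ = χ γ := by
    intro γ δ h
    obtain ⟨htr, hdet, hsnd⟩ := trace_det_snd_eq_of_isLocalStablyConjH (L := L) (v := v) w hsub hz h
    rw [hχ, hχ, htr, hdet, hsnd]
  have hχconj : ∀ δ x, χ (x * δ * x⁻¹) = χ δ := by
    intro δ x
    refine hχst δ (x * δ * x⁻¹) ⟨?_, ?_⟩
    · exact isConj_iff.2 ⟨(x.1).val, rfl⟩
    · exact isConj_iff.2 ⟨(x.2).val, rfl⟩
  -- `χ_z(h) = χ_z(z)` forces `h` over `z`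
  have hχz : ∀ h, χ h = χ z → (((((h * z⁻¹).1).val : GL (Fin 2) (UnitaryGroup.LocalRing L v)).val - 1) ^ 2 = 0 ∧ (h * z⁻¹).2 = 1) := by
    intro h hh
    rw [hχ, hχ, mul_inv_cancel] at hh
    have h1 : (((1 : (cmDatum L 2 (Matrix.of fun i j : Fin 2 => if i.val + j.val + 1 = 2 then (1 : L) else 0)).Local v ×
        (cmDatum L 1 (Matrix.of fun i j : Fin 1 => if i.val + j.val + 1 = 1 then (1 : L) else 0)).Local v).1).val : GL (Fin 2) (UnitaryGroup.LocalRing L v)).val = 1 := rfl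
    rw [h1, Matrix.trace_one, Matrix.det_one, Fintype.card_fin] at hh
    obtain ⟨h12, h2⟩ := Prod.mk.inj hh
    obtain ⟨htr, hdet⟩ := Prod.mk.inj h12
    exact ⟨sub_one_sq_eq_zero_of_trace_eq_two_of_det_eq_one _ (by rw [htr]; norm_num) hdet, h2⟩
  -- the open neighbourhood `V = χ⁻¹(χ(K))ᶜ`
  set K := tsupport F₁ with hK
  have hKc : IsCompact K := hF₁
  have hcl : IsClosed (χ '' K) := (hKc.image hχc).isClosed
  have hzV : z ∈ (χ ⁻¹' (χ '' K))ᶜ := by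
    intro hzK
    obtain ⟨h, hhK, hh⟩ := hzK
    exact hfar h hhK (hχz h hh)
  refine ⟨(χ ⁻¹' (χ '' K))ᶜ, (hcl.preimage hχc).isOpen_compl.mem_nhds hzV, fun γ hγ δ hδ x => ?_⟩
  apply image_eq_zero_of_notMem_tsupport
  intro hxK
  apply hγ
  refine ⟨x * δ * x⁻¹, hxK, ?_⟩
  rw [hχconj, hχst γ δ hδ]

end Central

end Literature.NumberTheory.Rogawski1990

end
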